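import Summits.QuantumFields.YangMills.Theorems.BalabanUVNodesN20HybridClassLawBudget

/-!
# BalabanUVNodes ∕ N19 — THE AFFINITY (HELLINGER ∕ LE CAM) CURRENCY AT THE CLASS INDEX: a two-run class-law gap is two-sidedly
# equivalent to the affinity defect `1 − 𝒜`, `1 − 𝒜 ≤ max_S |p(S) − q(S)| ≤ √(1 − 𝒜²)`; an UNSUMMABLE affinity defect at the key excludes
# `HybridNE7` for every choice of the six dials

Cell `pub-ymgap` (HUMAN RULING D-0062 Track A ∕ D-0149 width seats), WIDTH SEAT `pub-ymgap-dag-n19-w2` (node n19 = NE7, seat 2 of 3), generation g5,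
CLAIM-1 ∕ INTENT-1 (INBOX l.30368).  Route `Summits/QuantumFields/YangMills/Theses/BalabanUVNodes.lean`, key item K3⁷ `SpineGivenEndpointR13SepCoPH`
(stmt-QuantumFields-20544); filed `--kind proof --supports … --as helper`.  COUNT-NEUTRAL.  THEOREMS ONLY (0 `def`, 0 `instance`, 0 `sorry`); imports
dag-n20-w4's `…N20HybridClassLawBudget` ONLY (`not_exists_hybridNE7_of_unsummable_classLawGap`, `abs_classLaw_sub_classLaw_le_of_hybridNE7` CONSUMED BY
NAME; through it `T4MatchingAssembly.HybridNE7`, `Spine.NE7.Core`); edits nothing, re-declares nothing.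

WHY.  dag-n20-w4 (`…N20HybridClassLawBudget`, header READING (i)): at a pinned key the hybrid binder list `HybridNE7` pays at most a SUMMABLE across-class
total-variation budget `2(W_K + Wsh_K) + 2|vol·δ_K|` for the two runs' normalised laws `p(S) = Σ_S A ∕ Σ_T A`, `q(S) = Σ_S B ∕ Σ_T B` on the class
index, so the N19′∕N20∕N21 faces are jointly refutable at the pin by any UNSUMMABLE class-law gap — and (XG) must be read MASS-WEIGHTED: «two runs'
normalised class laws TV-far … (in the independent-block product picture … the binomial class laws ARE TV-far — not typed here)».  Deciding WHEN two
laws are TV-far is what the AFFINITY `𝒜 = Σ_τ √(p_τ q_τ)` (Bhattacharyya coefficient; `1 − 𝒜` = squared Hellinger distance) does two-sidedly, and — this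
seat's g4 point (`…N19TVProductBlocks`, `…Family`) — unlike TV it is EXACTLY multiplicative over independent blocks.  This file is the class-index half
(finite sums); the companion `…N19AffinityLargeFieldCount` runs the binomial large-field-count caricature on it, `…N19AffinityCurrency` is the one-class
measure-level half.

PRIOR ∕ ADJACENT IN THE CRUX DIRECTORY (read after this seat's CLAIM-1, aligned before filing).  ym-nodeO idea-3 g10's crux workfile
`Cruxes/SpineGivenEndpointR13SepCoPH/HellingerRoadSketch.lean` (06:37Z; ns `YMNodeOIdeate.Idea3.HellingerRoad`; card `Ideas/hellinger-free-energy-road.md`;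
CRIT-1 triage «SURVIVES priced», Rec. (d): helper lifts by width seats) checks, as a SKETCH WITH DEFINITIONS (`bc`, `l1`, `push`, `ber`, `fdef`), Le Cam both
ways (its §2), data processing (§4), tensorisation + the Bernoulli block + `bc_pi_ber` (§5), the free-energy reading (§6) and the necessity link through
dag-n20-w4 (§7).  Cruxes workfiles are not importable from `Theorems/`; this file is the DEF-FREE theorems-side statement of the Le Cam half (affinity spelled
out as `Σ_T √(p q)`), typed independently, with two additions the sketch does not carry: the HAHN-SET form of the lower inequality (an explicit separating
set of classes, which is what dag-n20-w4's `∃ S ⊆ T K` guard consumes) and the guard restated in `1 − 𝒜` letters (§3).  The s-calculus of the interpolated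
free energy (card P2, `fdef_le_variance`) is dag-n20-w4 g2's CLAIM (l.30428), the t-calculus dag-n19-w4 g4's (l.30570) — neither is touched here.

WHAT IS PROVED ([folklore]: Le Cam's inequalities, e.g. LeCam 1973 ∕ Tsybakov 2009 Lemma 2.3 ∕ Ghosal–van der Vaart 2017 Lemma B.1; finite-sum form, NO
definition — the affinity is SPELLED OUT).
* §0 real arithmetic: `|x − y| = |√x − √y|(√x + √y)` · `A ≤ e^{−(1−A)}` · `A^n ≤ e^{−n(1−A)}` · `min(x,1)∕2 ≤ 1 − e^{−x}` ·
  `summable_of_summable_min_one` (the two summability letters the companion's caricature uses); `(√x − √y)² ≤ |x − y|` and AM–GM are the tree's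
  `Literature.Analysis.FunctionSpaces.sq_sqrt_sub_sqrt_le` ∕ `Literature.Analysis.FluidPDE.sqrt_mul_le_add_half` (inlined as `have`s — their home
  modules carry Itô-process ∕ Navier–Stokes imports foreign to this lane).
* §1 two probability vectors `p, q ≥ 0` on a finite index set `T` (`Σ_T p = Σ_T q = 1`), `𝒜 := Σ_T √(p q)`: `affinity_nonneg` · `affinity_le_one` ·
  `sum_sq_sqrt_sub_sqrt_eq` (`Σ(√p − √q)² = 2 − 2𝒜`) · ★ `two_mul_one_sub_affinity_le_sum_abs_sub` (`2(1 − 𝒜) ≤ Σ|q − p|`) · `sum_abs_sub_eq_two_mul_sum_filter`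
  (the Hahn set `{p < q}` carries half of `Σ|q − p|`) · ★★ `one_sub_affinity_le_hahnGap` (`1 − 𝒜 ≤ q{p < q} − p{p < q}`: TV-FAR when `𝒜` is small) ·
  `abs_sum_sub_sum_le_half_sum_abs` · ★ `sum_abs_sub_le_two_mul_sqrt` (`Σ|q − p| ≤ 2√(1 − 𝒜²)`, Cauchy–Schwarz) · ★★ `abs_sum_sub_sum_le_sqrt_one_sub_affinity_sq`
  (every `S ⊆ T`: `|q(S) − p(S)| ≤ √(1 − 𝒜²)`: TV-NEAR when `𝒜` is near `1`).
* §2 the same in dag-n20-w4's class-law letters for two nonnegative weight families `A, B` with positive totals: ★★ `exists_classLawGap_ge_one_sub_affinity` ·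
  ★ `abs_classLawGap_le_sqrt_one_sub_affinity_sq`.
* §3 ★★ `not_exists_hybridNE7_of_unsummable_affinityDefect`: if at every level some admissible source value exhibits an affinity defect `1 − 𝒜_K ≥ g_K ≥ 0`
  with `g` NOT summable, NO `Bad, W, shA, shB, Wsh, δ` give `HybridNE7` at the key (dag-n20-w4's guard fed by §2) · `not_coreEdge_of_unsummable_affinityDefect`
  (the N19′ slot's own shape at fixed admissible weights and shells).
READING.  The affinity is the natural letter for (XG): the class-law gap is UNSUMMABLE iff the affinity defect is (`1 − 𝒜 ≤ gap ≤ √(1 − 𝒜²) ≤ √2·√(1 − 𝒜)` —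
summability of `gap_K` and of `√(1 − 𝒜_K)` differ, but «gap ↛ 0» ⟺ «𝒜 ↛ 1»); and for class pieces that are PRODUCTS over independent blocks `𝒜 = ∏_b 𝒜_b`
exactly (companion files), so «TV-far» ⟺ «Σ_b (1 − 𝒜_b) ≳ 1».

HONEST FRAMING.  [folklore] finite-sum ∕ real arithmetic on the tree's SHAPES (`HybridNE7`, `Core` occur as HYPOTHESES only); NO estimate of the programme is
proved; nothing of Bałaban's is asserted or instantiated (no `Provisos₁₃CoPH` tuple, no reading of record is touched); NE7 ∕ NE7b ∕ NE7c NOT PRINTED as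
two-run statements for d = 4 and NOT proved; N19 ∕ N20 ∕ N21 NOT discharged; K3⁷ OPEN, not claimed, v5 untouched; no summit statement is proved by this
seat; counts UNMOVED (typed 28∕28 · discharged 5∕27, A 5∕28).  One finite four-torus programme at fixed ε — NOT ℝ⁴, NOT infinite volume, NOT OS, NOT a
mass gap, NOT the Clay problem (R4 closes the conditional finite-𝕋⁴ rung `BalabanLadder.UV` only).  0 `def`; 0 `sorry`; standard axioms.
-/

noncomputable section

namespace Summit.QuantumFields.YangMills.BalabanUVNodes.N19AffinityClassIndexLaws

open Finset Filter
open Summit.QuantumFields.BalabanUV.T4Continuum.Spine.NE7 (Core)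
open Literature.MathematicalPhysics.QuantumFieldTheory.Balaban1983to89
open T4WeightBudget (RelWeightBound)
open T4IndicatorShell (ShellWeightBound)
open T4MatchingAssembly (HybridNE7)
open Summit.QuantumFields.YangMills.BalabanUVNodes.N20HybridClassLawBudget
  (not_exists_hybridNE7_of_unsummable_classLawGap not_coreEdge_of_unsummable_classLawGap)

/-! ## §0 Real arithmetic [folklore] -/

section Arith

/-- `|x − y| = |√x − √y|·(√x + √y)` for `x, y ≥ 0`. [folklore] -/
theorem abs_sub_eq_abs_sqrt_sub_mul {x y : ℝ} (hx : 0 ≤ x) (hy : 0 ≤ y) :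
    |x - y| = |Real.sqrt x - Real.sqrt y| * (Real.sqrt x + Real.sqrt y) := by
  have h : (Real.sqrt x - Real.sqrt y) * (Real.sqrt x + Real.sqrt y) = x - y := by
    calc (Real.sqrt x - Real.sqrt y) * (Real.sqrt x + Real.sqrt y)
        = Real.sqrt x * Real.sqrt x - Real.sqrt y * Real.sqrt y := by ring
      _ = x - y := by rw [Real.mul_self_sqrt hx, Real.mul_self_sqrt hy]
  rw [← h, abs_mul, abs_of_nonneg (add_nonneg (Real.sqrt_nonneg x) (Real.sqrt_nonneg y))]

/-- `A ≤ e^{−(1 − A)}` (`1 + x ≤ eˣ` at `x = A − 1`). [folklore] -/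
theorem le_exp_neg_one_sub (A : ℝ) : A ≤ Real.exp (-(1 - A)) := by
  have h := Real.add_one_le_exp (-(1 - A))
  linarith

/-- `A^n ≤ e^{−n(1 − A)}` for `A ≥ 0`: a product of `n` affinities `A` is exponentially small in `n·(1 − A)`. [folklore] -/
theorem pow_le_exp_neg_mul_one_sub {A : ℝ} (hA : 0 ≤ A) (n : ℕ) : A ^ n ≤ Real.exp (-(n * (1 - A))) := by
  calc A ^ n ≤ (Real.exp (-(1 - A))) ^ n := pow_le_pow_left₀ hA (le_exp_neg_one_sub A) n
    _ = Real.exp (-(n * (1 - A))) := by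
        rw [← Real.exp_nat_mul]
        congr 1
        ring

/-- `min(x, 1)∕2 ≤ 1 − e^{−x}` for `x ≥ 0` (through `e^{−x} ≤ 1∕(1 + x)`). [folklore] -/
theorem half_min_le_one_sub_exp_neg {x : ℝ} (hx : 0 ≤ x) : min x 1 / 2 ≤ 1 - Real.exp (-x) := by
  have h1x : 0 < 1 + x := by linarith
  have h1 : Real.exp (-x) * (1 + x) ≤ 1 := by
    have h := Real.add_one_le_exp x
    have hpos := Real.exp_pos (-x)
    calc Real.exp (-x) * (1 + x) ≤ Real.exp (-x) * Real.exp x :=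
          mul_le_mul_of_nonneg_left (by linarith) hpos.le
      _ = 1 := by rw [← Real.exp_add]; simp
  have h2 : min x 1 / 2 * (1 + x) ≤ x := by
    rcases le_total x 1 with h | h
    · rw [min_eq_left h]; nlinarith
    · rw [min_eq_right h]; nlinarith
  -- `min∕2 ≤ x∕(1+x) = 1 − 1∕(1+x) ≤ 1 − e^{−x}`, cleared of denominators
  nlinarith [mul_nonneg (sub_nonneg.2 h1) hx, Real.exp_pos (-x)]

/-- If `Σ_K min(x_K, 1) < ∞` then `Σ_K x_K < ∞` (the capped terms tend to `0`, so the cap is eventually inactive; no sign condition). [folklore] -/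
theorem summable_of_summable_min_one {x : ℕ → ℝ} (h : Summable fun K => min (x K) 1) : Summable x := by
  have hev : ∀ᶠ K in atTop, min (x K) 1 < 1 := (tendsto_order.1 h.tendsto_atTop_zero).2 1 one_pos
  obtain ⟨N, hN⟩ := eventually_atTop.1 hev
  have heq : ∀ K, N ≤ K → min (x K) 1 = x K := fun K hK => by
    rcases le_total (x K) 1 with h' | h'
    · exact min_eq_left h'
    · have := hN K hK
      rw [min_eq_right h'] at this
      exact absurd this (lt_irrefl 1)
  rw [← summable_nat_add_iff N] at h ⊢
  exact h.congr fun K => heq (K + N) (Nat.le_add_left N K)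

end Arith

/-! ## §1 Le Cam's two inequalities for two probability vectors on a finite index set [folklore] -/

section LeCam

variable {ι : Type*} (T : Finset ι) {p q : ι → ℝ}

/-- `0 ≤ 𝒜 = Σ_T √(p q)`. [folklore] -/
theorem affinity_nonneg : 0 ≤ ∑ τ ∈ T, Real.sqrt (p τ * q τ) :=
  sum_nonneg fun _ _ => Real.sqrt_nonneg _

/-- `𝒜 ≤ 1` for two probability vectors (AM–GM termwise). [folklore] -/
theorem affinity_le_one (hp : ∀ τ ∈ T, 0 ≤ p τ) (hq : ∀ τ ∈ T, 0 ≤ q τ) (hp1 : ∑ τ ∈ T, p τ = 1)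
    (hq1 : ∑ τ ∈ T, q τ = 1) : ∑ τ ∈ T, Real.sqrt (p τ * q τ) ≤ 1 := by
  -- AM–GM termwise (the tree's `Literature.Analysis.FluidPDE.sqrt_mul_le_add_half`, inlined to keep the imports local)
  have amgm : ∀ τ ∈ T, Real.sqrt (p τ * q τ) ≤ (p τ + q τ) / 2 := fun τ hτ => by
    rw [Real.sqrt_mul (hp τ hτ)]
    nlinarith [sq_nonneg (Real.sqrt (p τ) - Real.sqrt (q τ)), Real.sq_sqrt (hp τ hτ), Real.sq_sqrt (hq τ hτ)]
  calc ∑ τ ∈ T, Real.sqrt (p τ * q τ) ≤ ∑ τ ∈ T, (p τ + q τ) / 2 := sum_le_sum amgm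
    _ = 1 := by rw [← sum_div, sum_add_distrib, hp1, hq1]; norm_num

/-- `Σ_T (√p − √q)² = 2 − 2𝒜` (twice the squared Hellinger distance). [folklore] -/
theorem sum_sq_sqrt_sub_sqrt_eq (hp : ∀ τ ∈ T, 0 ≤ p τ) (hq : ∀ τ ∈ T, 0 ≤ q τ) (hp1 : ∑ τ ∈ T, p τ = 1)
    (hq1 : ∑ τ ∈ T, q τ = 1) :
    ∑ τ ∈ T, (Real.sqrt (p τ) - Real.sqrt (q τ)) ^ 2 = 2 - 2 * ∑ τ ∈ T, Real.sqrt (p τ * q τ) := by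
  have h : ∀ τ ∈ T, (Real.sqrt (p τ) - Real.sqrt (q τ)) ^ 2 = p τ + q τ - 2 * Real.sqrt (p τ * q τ) :=
    fun τ hτ => by
      rw [sub_sq, Real.sq_sqrt (hp τ hτ), Real.sq_sqrt (hq τ hτ), Real.sqrt_mul (hp τ hτ)]
      ring
  rw [sum_congr rfl h, sum_sub_distrib, sum_add_distrib, hp1, hq1, ← mul_sum]
  ring

/-- `Σ_T (√p + √q)² = 2 + 2𝒜`. [folklore] -/
theorem sum_sq_sqrt_add_sqrt_eq (hp : ∀ τ ∈ T, 0 ≤ p τ) (hq : ∀ τ ∈ T, 0 ≤ q τ) (hp1 : ∑ τ ∈ T, p τ = 1)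
    (hq1 : ∑ τ ∈ T, q τ = 1) :
    ∑ τ ∈ T, (Real.sqrt (p τ) + Real.sqrt (q τ)) ^ 2 = 2 + 2 * ∑ τ ∈ T, Real.sqrt (p τ * q τ) := by
  have h : ∀ τ ∈ T, (Real.sqrt (p τ) + Real.sqrt (q τ)) ^ 2 = p τ + q τ + 2 * Real.sqrt (p τ * q τ) :=
    fun τ hτ => by
      rw [add_sq, Real.sq_sqrt (hp τ hτ), Real.sq_sqrt (hq τ hτ), Real.sqrt_mul (hp τ hτ)]
      ring
  rw [sum_congr rfl h, sum_add_distrib, sum_add_distrib, hp1, hq1, ← mul_sum]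
  ring

/-- ★ **LE CAM, LOWER**: `2(1 − 𝒜) ≤ Σ_T |q − p|`. [folklore] -/
theorem two_mul_one_sub_affinity_le_sum_abs_sub (hp : ∀ τ ∈ T, 0 ≤ p τ) (hq : ∀ τ ∈ T, 0 ≤ q τ)
    (hp1 : ∑ τ ∈ T, p τ = 1) (hq1 : ∑ τ ∈ T, q τ = 1) :
    2 * (1 - ∑ τ ∈ T, Real.sqrt (p τ * q τ)) ≤ ∑ τ ∈ T, |q τ - p τ| := by
  have h := sum_sq_sqrt_sub_sqrt_eq T hp hq hp1 hq1
  -- `(√x − √y)² ≤ |x − y|` termwise: the smaller of `x, y` is at most `√x·√y` (the tree's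
  -- `Literature.Analysis.FunctionSpaces.sq_sqrt_sub_sqrt_le`, inlined to keep the imports local)
  have hterm : ∀ τ ∈ T, (Real.sqrt (p τ) - Real.sqrt (q τ)) ^ 2 ≤ |p τ - q τ| := fun τ hτ => by
    have hxx : Real.sqrt (p τ) * Real.sqrt (p τ) = p τ := Real.mul_self_sqrt (hp τ hτ)
    have hyy : Real.sqrt (q τ) * Real.sqrt (q τ) = q τ := Real.mul_self_sqrt (hq τ hτ)
    rcases le_total (p τ) (q τ) with hle | hle
    · have hs : Real.sqrt (p τ) * Real.sqrt (p τ) ≤ Real.sqrt (p τ) * Real.sqrt (q τ) :=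
        mul_le_mul_of_nonneg_left (Real.sqrt_le_sqrt hle) (Real.sqrt_nonneg _)
      rw [abs_of_nonpos (sub_nonpos.2 hle)]
      nlinarith
    · have hs : Real.sqrt (q τ) * Real.sqrt (q τ) ≤ Real.sqrt (q τ) * Real.sqrt (p τ) :=
        mul_le_mul_of_nonneg_left (Real.sqrt_le_sqrt hle) (Real.sqrt_nonneg _)
      rw [abs_of_nonneg (sub_nonneg.2 hle)]
      nlinarith
  calc 2 * (1 - ∑ τ ∈ T, Real.sqrt (p τ * q τ)) = ∑ τ ∈ T, (Real.sqrt (p τ) - Real.sqrt (q τ)) ^ 2 := by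
        rw [h]; ring
    _ ≤ ∑ τ ∈ T, |p τ - q τ| := sum_le_sum hterm
    _ = ∑ τ ∈ T, |q τ - p τ| := sum_congr rfl fun τ _ => abs_sub_comm _ _

/-- The HAHN SET `{p < q}` carries exactly half of `Σ_T |q − p|` when the totals agree. [folklore] -/
theorem sum_abs_sub_eq_two_mul_sum_filter (hpq : ∑ τ ∈ T, p τ = ∑ τ ∈ T, q τ) :
    ∑ τ ∈ T, |q τ - p τ| = 2 * ∑ τ ∈ T.filter (fun τ => p τ < q τ), (q τ - p τ) := by
  have hsplit := sum_filter_add_sum_filter_not T (fun τ => p τ < q τ) (fun τ => |q τ - p τ|)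
  have hsplit0 := sum_filter_add_sum_filter_not T (fun τ => p τ < q τ) (fun τ => q τ - p τ)
  have h0 : ∑ τ ∈ T, (q τ - p τ) = 0 := by rw [sum_sub_distrib, hpq, sub_self]
  have hpos : ∑ τ ∈ T.filter (fun τ => p τ < q τ), |q τ - p τ| =
      ∑ τ ∈ T.filter (fun τ => p τ < q τ), (q τ - p τ) :=
    sum_congr rfl fun τ hτ => abs_of_pos (sub_pos.2 (mem_filter.1 hτ).2)
  have hneg : ∑ τ ∈ T.filter (fun τ => ¬ p τ < q τ), |q τ - p τ| =
      -∑ τ ∈ T.filter (fun τ => ¬ p τ < q τ), (q τ - p τ) := by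
    rw [← sum_neg_distrib]
    exact sum_congr rfl fun τ hτ => abs_of_nonpos (sub_nonpos.2 (not_lt.1 (mem_filter.1 hτ).2))
  linarith

/-- ★★ **TV-FAR WHEN THE AFFINITY IS SMALL**: the Hahn set has class-law gap `q{p < q} − p{p < q} ≥ 1 − 𝒜`. [folklore] -/
theorem one_sub_affinity_le_hahnGap (hp : ∀ τ ∈ T, 0 ≤ p τ) (hq : ∀ τ ∈ T, 0 ≤ q τ) (hp1 : ∑ τ ∈ T, p τ = 1)
    (hq1 : ∑ τ ∈ T, q τ = 1) :
    1 - ∑ τ ∈ T, Real.sqrt (p τ * q τ) ≤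
      ∑ τ ∈ T.filter (fun τ => p τ < q τ), q τ - ∑ τ ∈ T.filter (fun τ => p τ < q τ), p τ := by
  rw [← sum_sub_distrib]
  have h1 := two_mul_one_sub_affinity_le_sum_abs_sub T hp hq hp1 hq1
  have h2 := sum_abs_sub_eq_two_mul_sum_filter T (hp1.trans hq1.symm)
  linarith

/-- Every `S ⊆ T`: `|q(S) − p(S)| ≤ ½·Σ_T |q − p|` when the totals agree (`S` and `T ∖ S` carry opposite differences). [folklore] -/
theorem abs_sum_sub_sum_le_half_sum_abs [DecidableEq ι] {S : Finset ι} (hS : S ⊆ T)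
    (hpq : ∑ τ ∈ T, p τ = ∑ τ ∈ T, q τ) :
    |∑ τ ∈ S, q τ - ∑ τ ∈ S, p τ| ≤ (∑ τ ∈ T, |q τ - p τ|) / 2 := by
  have h0 : ∑ τ ∈ T, (q τ - p τ) = 0 := by rw [sum_sub_distrib, hpq, sub_self]
  have hTS := sum_sdiff hS (f := fun τ => q τ - p τ)
  have hTSabs := sum_sdiff hS (f := fun τ => |q τ - p τ|)
  have h1 : |∑ τ ∈ S, (q τ - p τ)| ≤ ∑ τ ∈ S, |q τ - p τ| := abs_sum_le_sum_abs _ _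
  have h2 : |∑ τ ∈ T \ S, (q τ - p τ)| ≤ ∑ τ ∈ T \ S, |q τ - p τ| := abs_sum_le_sum_abs _ _
  have h3 : ∑ τ ∈ T \ S, (q τ - p τ) = -∑ τ ∈ S, (q τ - p τ) := by linarith
  rw [h3, abs_neg] at h2
  rw [← sum_sub_distrib]
  linarith

/-- ★ **LE CAM, UPPER**: `Σ_T |q − p| ≤ 2√(1 − 𝒜²)` (Cauchy–Schwarz on `|√p − √q|·(√p + √q)`). [folklore] -/
theorem sum_abs_sub_le_two_mul_sqrt (hp : ∀ τ ∈ T, 0 ≤ p τ) (hq : ∀ τ ∈ T, 0 ≤ q τ) (hp1 : ∑ τ ∈ T, p τ = 1)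
    (hq1 : ∑ τ ∈ T, q τ = 1) :
    ∑ τ ∈ T, |q τ - p τ| ≤ 2 * Real.sqrt (1 - (∑ τ ∈ T, Real.sqrt (p τ * q τ)) ^ 2) := by
  have hA0 := affinity_nonneg T (p := p) (q := q)
  have hA1 := affinity_le_one T hp hq hp1 hq1
  have hrepr : ∑ τ ∈ T, |q τ - p τ| =
      ∑ τ ∈ T, |Real.sqrt (p τ) - Real.sqrt (q τ)| * (Real.sqrt (p τ) + Real.sqrt (q τ)) :=
    sum_congr rfl fun τ hτ => by rw [abs_sub_comm]; exact abs_sub_eq_abs_sqrt_sub_mul (hp τ hτ) (hq τ hτ)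
  have hCS := sum_mul_sq_le_sq_mul_sq T (fun τ => |Real.sqrt (p τ) - Real.sqrt (q τ)|)
    (fun τ => Real.sqrt (p τ) + Real.sqrt (q τ))
  have hm : ∑ τ ∈ T, |Real.sqrt (p τ) - Real.sqrt (q τ)| ^ 2 = 2 - 2 * ∑ τ ∈ T, Real.sqrt (p τ * q τ) := by
    rw [← sum_sq_sqrt_sub_sqrt_eq T hp hq hp1 hq1]
    exact sum_congr rfl fun τ _ => sq_abs _
  have hpl := sum_sq_sqrt_add_sqrt_eq T hp hq hp1 hq1
  rw [hm, hpl] at hCS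
  have hX : 0 ≤ ∑ τ ∈ T, |Real.sqrt (p τ) - Real.sqrt (q τ)| * (Real.sqrt (p τ) + Real.sqrt (q τ)) :=
    sum_nonneg fun τ _ => mul_nonneg (abs_nonneg _) (add_nonneg (Real.sqrt_nonneg _) (Real.sqrt_nonneg _))
  have h1A : 0 ≤ 1 - (∑ τ ∈ T, Real.sqrt (p τ * q τ)) ^ 2 := by nlinarith
  rw [hrepr, ← pow_le_pow_iff_left₀ hX (by positivity) two_ne_zero, mul_pow, Real.sq_sqrt h1A]
  nlinarith

/-- ★★ **TV-NEAR WHEN THE AFFINITY IS NEAR ONE**: every `S ⊆ T` has `|q(S) − p(S)| ≤ √(1 − 𝒜²)`. [folklore] -/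
theorem abs_sum_sub_sum_le_sqrt_one_sub_affinity_sq [DecidableEq ι] {S : Finset ι} (hS : S ⊆ T)
    (hp : ∀ τ ∈ T, 0 ≤ p τ) (hq : ∀ τ ∈ T, 0 ≤ q τ) (hp1 : ∑ τ ∈ T, p τ = 1) (hq1 : ∑ τ ∈ T, q τ = 1) :
    |∑ τ ∈ S, q τ - ∑ τ ∈ S, p τ| ≤ Real.sqrt (1 - (∑ τ ∈ T, Real.sqrt (p τ * q τ)) ^ 2) := by
  have h1 := abs_sum_sub_sum_le_half_sum_abs T hS (hp1.trans hq1.symm)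
  have h2 := sum_abs_sub_le_two_mul_sqrt T hp hq hp1 hq1
  linarith

end LeCam

/-! ## §2 The same in class-law letters: two nonnegative weight families with positive totals [folklore] -/

section ClassLaw

variable {ι : Type*} (T : Finset ι) {A B : ι → ℝ}

/-- Normalised weights are a probability vector: nonnegative … [folklore] -/
theorem div_total_nonneg (hA : ∀ τ ∈ T, 0 ≤ A τ) (hZ : 0 < ∑ τ ∈ T, A τ) :
    ∀ τ ∈ T, 0 ≤ A τ / ∑ τ' ∈ T, A τ' := fun τ hτ => div_nonneg (hA τ hτ) hZ.le

/-- … summing to one. [folklore] -/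
theorem sum_div_total_eq_one (hZ : 0 < ∑ τ ∈ T, A τ) : ∑ τ ∈ T, A τ / ∑ τ' ∈ T, A τ' = 1 := by
  rw [← sum_div, div_self hZ.ne']

/-- ★★ **A CLASS-LAW GAP OF AT LEAST THE AFFINITY DEFECT.**  Nonnegative weights `A, B` on `T` with positive totals: SOME `S ⊆ T` (the Hahn set
`{A∕Σ A < B∕Σ B}`) has `|Σ_S A∕Σ_T A − Σ_S B∕Σ_T B| ≥ 1 − 𝒜`, `𝒜 = Σ_T √((A∕Σ_T A)(B∕Σ_T B))` — dag-n20-w4's gap letter, lower-bounded. [folklore] -/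
theorem exists_classLawGap_ge_one_sub_affinity (hA : ∀ τ ∈ T, 0 ≤ A τ) (hB : ∀ τ ∈ T, 0 ≤ B τ)
    (hZA : 0 < ∑ τ ∈ T, A τ) (hZB : 0 < ∑ τ ∈ T, B τ) :
    ∃ S ⊆ T, 1 - ∑ τ ∈ T, Real.sqrt ((A τ / ∑ τ' ∈ T, A τ') * (B τ / ∑ τ' ∈ T, B τ')) ≤
      |(∑ τ ∈ S, A τ) / (∑ τ ∈ T, A τ) - (∑ τ ∈ S, B τ) / (∑ τ ∈ T, B τ)| := by
  refine ⟨T.filter (fun τ => A τ / ∑ τ' ∈ T, A τ' < B τ / ∑ τ' ∈ T, B τ'), filter_subset _ _, ?_⟩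
  have h := one_sub_affinity_le_hahnGap T (div_total_nonneg T hA hZA) (div_total_nonneg T hB hZB)
    (sum_div_total_eq_one T hZA) (sum_div_total_eq_one T hZB)
  rw [← sum_div, ← sum_div] at h
  rw [abs_sub_comm]
  exact h.trans (le_abs_self _)

/-- ★ **EVERY CLASS-LAW GAP IS AT MOST `√(1 − 𝒜²)`.** [folklore] -/
theorem abs_classLawGap_le_sqrt_one_sub_affinity_sq [DecidableEq ι] (hA : ∀ τ ∈ T, 0 ≤ A τ) (hB : ∀ τ ∈ T, 0 ≤ B τ)
    (hZA : 0 < ∑ τ ∈ T, A τ) (hZB : 0 < ∑ τ ∈ T, B τ) {S : Finset ι} (hS : S ⊆ T) :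
    |(∑ τ ∈ S, A τ) / (∑ τ ∈ T, A τ) - (∑ τ ∈ S, B τ) / (∑ τ ∈ T, B τ)| ≤
      Real.sqrt (1 - (∑ τ ∈ T, Real.sqrt ((A τ / ∑ τ' ∈ T, A τ') * (B τ / ∑ τ' ∈ T, B τ'))) ^ 2) := by
  have h := abs_sum_sub_sum_le_sqrt_one_sub_affinity_sq T hS (div_total_nonneg T hA hZA)
    (div_total_nonneg T hB hZB) (sum_div_total_eq_one T hZA) (sum_div_total_eq_one T hZB)
  rw [← sum_div, ← sum_div] at h
  rwa [abs_sub_comm]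

end ClassLaw

/-! ## §3 The disprover's handle in affinity letters: an unsummable affinity defect at the key excludes `HybridNE7` for all six dials -/

section Handle

variable {ι : Type*} [DecidableEq ι] {l₀ vol : ℝ} {T : ℕ → Finset ι} {A B shA shB : ℕ → ℝ → ι → ℝ}
  {Bad : ℕ → ℝ → Finset ι} {W Wsh : ℕ → ℝ}

/-- ★★ **KERNEL GUARD IN AFFINITY LETTERS, ALL SIX DIALS FREE** [folklore].  If at every level `K` some admissible source value with nonnegative
weights and positive totals has affinity defect `1 − Σ_T √((A∕Σ A)(B∕Σ B)) ≥ g_K ≥ 0` with `g` NOT summable, then at the key `(T, A, B)` there are NO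
`Bad, W, shA, shB, Wsh, δ` with `HybridNE7 l₀ vol T A B Bad W shA shB Wsh δ` — dag-n20-w4's `not_exists_hybridNE7_of_unsummable_classLawGap` BY NAME,
fed by §2's Hahn-set gap. -/
theorem not_exists_hybridNE7_of_unsummable_affinityDefect {g : ℕ → ℝ} (hg0 : ∀ K, 0 ≤ g K) (hg : ¬ Summable g)
    (hdef : ∀ K : ℕ, ∃ t : ℝ, |t| ≤ l₀ ∧ (∀ τ ∈ T K, 0 ≤ A K t τ) ∧ (∀ τ ∈ T K, 0 ≤ B K t τ) ∧
      0 < ∑ τ ∈ T K, A K t τ ∧ 0 < ∑ τ ∈ T K, B K t τ ∧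
      g K ≤ 1 - ∑ τ ∈ T K, Real.sqrt ((A K t τ / ∑ τ' ∈ T K, A K t τ') * (B K t τ / ∑ τ' ∈ T K, B K t τ'))) :
    ¬ ∃ (Bad : ℕ → ℝ → Finset ι) (W : ℕ → ℝ) (shA shB : ℕ → ℝ → ι → ℝ) (Wsh δ : ℕ → ℝ),
      HybridNE7 l₀ vol T A B Bad W shA shB Wsh δ :=
  not_exists_hybridNE7_of_unsummable_classLawGap hg0 hg fun K => by
    obtain ⟨t, ht, hA, hB, hZA, hZB, hle⟩ := hdef K
    obtain ⟨S, hS, hgap⟩ := exists_classLawGap_ge_one_sub_affinity (T K) hA hB hZA hZB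
    exact ⟨t, ht, hZA, hZB, S, hS, hle.trans hgap⟩

/-- AT FIXED ADMISSIBLE WEIGHTS AND SHELLS (the N19′ slot's own shape): NE7b's `RelWeightBound`, NE7c's `ShellWeightBound`, `W + Wsh < 1` and an
unsummable affinity defect exclude `∃ δ, Core … (A − shA) (B − shB) δ ∧ Summable δ` — dag-n20-w4's `not_coreEdge_of_unsummable_classLawGap` BY NAME. [folklore] -/
theorem not_coreEdge_of_unsummable_affinityDefect (hW : RelWeightBound l₀ T A B Bad W)
    (hSh : ShellWeightBound l₀ T A B shA shB Wsh) (hlt : ∀ K, W K + Wsh K < 1) {g : ℕ → ℝ} (hg0 : ∀ K, 0 ≤ g K)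
    (hg : ¬ Summable g)
    (hdef : ∀ K : ℕ, ∃ t : ℝ, |t| ≤ l₀ ∧ (∀ τ ∈ T K, 0 ≤ A K t τ) ∧ (∀ τ ∈ T K, 0 ≤ B K t τ) ∧
      0 < ∑ τ ∈ T K, A K t τ ∧ 0 < ∑ τ ∈ T K, B K t τ ∧
      g K ≤ 1 - ∑ τ ∈ T K, Real.sqrt ((A K t τ / ∑ τ' ∈ T K, A K t τ') * (B K t τ / ∑ τ' ∈ T K, B K t τ'))) :
    ¬ ∃ δ : ℕ → ℝ, Core l₀ vol T Bad (fun K t τ => A K t τ - shA K t τ) (fun K t τ => B K t τ - shB K t τ) δ ∧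
      Summable δ :=
  not_coreEdge_of_unsummable_classLawGap hW hSh hlt hg0 hg fun K => by
    obtain ⟨t, ht, hA, hB, hZA, hZB, hle⟩ := hdef K
    obtain ⟨S, hS, hgap⟩ := exists_classLawGap_ge_one_sub_affinity (T K) hA hB hZA hZB
    exact ⟨t, ht, hZA, hZB, S, hS, hle.trans hgap⟩

end Handle

end Summit.QuantumFields.YangMills.BalabanUVNodes.N19AffinityClassIndexLaws

end
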